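import Summits.BirchSwinnertonDyer.BirchSwinnertonDyer.Theorems.RamifiedSevenEllipticUnitsValueOfKMCImpReading
import Summits.BirchSwinnertonDyer.BirchSwinnertonDyer.Theorems.KatoDescentPotSupersingularReducibleFineSelmerMuZeroCharForm
import Summits.BirchSwinnertonDyer.BirchSwinnertonDyer.Theorems.SmallImageMuTransferMuTransferStubX9MuBookkeeping
import Summits.BirchSwinnertonDyer.Rank1Residual.X12.CMRamifiedReducible
import Literature.NumberTheory.EllipticCurves.IwasawaModuleFinitePadicIntProofs
import Literature.NumberTheory.EllipticCurves.KatoFineSelmerDualUniquenessProofs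
import Literature.NumberTheory.EllipticCurves.Kato2004.IwasawaH1RankLeOneProofs
import Literature.NumberTheory.EllipticCurves.Kato2004.IwasawaH1FreeOfNoRationalTorsionProofs
import Summits.BirchSwinnertonDyer.Rank1Residual.Additive.KatoDescentIntegralH1RankOne
import HarnessLib

set_option autoImplicit false

/-!
# Kato's `μ`-equality at `(7)` on the class `𝒞₇`, POINTWISE from residual non-vanishing `z₀ ∉ (7)·𝐇¹`
# (crux stmt-BirchSwinnertonDyer-19945 `EllipticUnitValueSevenOfGZK`, zp line; the (K2-PORT) of the crux workfile
# `Cruxes/EllipticUnitValueSevenOfGZK/KatoMuAbelianResidueSketch.lean` REV 2.1, sha16 `fa0c9df051cecfd6`)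

Seat `bsd-cm-prr-ty1` (generation 26, literature-prover; cell `bsd-cm`, HOME `run/shared/lean/pub/bsd-cm/`), planner word
(K2-PORT) = SUMMON `wake/SUMMON-bsd-cm-prr-ty1-20260830T0629Z.md` (D860/D861/D863).  The ideator `bsd-idea-20` (g53–g54,
critic `idea-crit-15` V#22bj–bm PASS) proved §§1–3 of REV 2.1 kernel-side, but under `Cruxes/` with three `Prop` definitions
(`FineDualFGSeven`, `KatoPrimitiveSeven`, `ResidualNonvanishingSeven`), which a registered skeleton cannot import.  THIS FILE
is the consumable port: THEOREMS ONLY (no `def`, no named fact, no instance, no notation, no `sorry`), the same ten imports,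
the three `Prop`s INLINED as hypotheses/conclusions, proofs carried over (tree twins cited where `lean search` found them).

## Exports

* §1 (Selmer side, statement (A) on `𝒞₇`): `conjA_seven_of_classCSeven`, `finite_sevenTorsion_fineSelmerInfty_of_classCSeven`,
  `moduleFinite_fineSelmerDual_of_finite_pTorsion_anyKey` (Nakayama for the dual pair at an ARBITRARY key — the tree's
  `FineSelmerDualData.module_finite_of_finite_pTorsion` minus its `IsTopGenerator` hypothesis),
  `lengthAt_seven_fineSelmerDual_eq_zero_of_classCSeven` (`length_{(7)} Y.X = 0` for EVERY dual fine Selmer datum `Y` of ANY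
  key of a `𝒞₇` member — no finiteness binder left).
* §2 (zeta side, DVR arithmetic in `Λ_{(7)}`): `torsionBy_eq_bot_of_not_dvd_torsionOrder`,
  `lengthAt_seven_quotient_span_eq_zero_of_not_mem` (granted GZK: `z ∉ 7·𝐇¹ ⟹ length_{(7)}(𝐇¹ ⧸ Λz) = 0`), the
  UNCONDITIONAL converse `not_mem_seven_smul_top_of_lengthAt_quotient_span_eq_zero` and the iff — (P3).
* §3 the skeleton-facing statements: **(P1)** `lengthAt_seven_fineSelmerDual_eq_lengthAt_quotient_span_of_not_mem` — the
  POINTWISE `μ`-equality `length_{(7)} Y.X = length_{(7)} (𝐇¹ ⧸ Λz₀)` from `z₀ ∉ augIdealP 7 • ⊤`, NO admissibility and NO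
  height hypothesis (type = planner scratch `kato_perrin_riou_zp.v10_scratch.lean` `portP1_standin` letter for letter);
  **(P2)** `stubKatoMuEqualitySeven_of_residualNonvanishing` — conclusion = the type of the registered stub
  `KatoPerrinRiouZp.stub_katoMuEqualitySeven` (skeleton v9 `7f643694dfb0cab1`, l. 229–237) VERBATIM, from
  {char-form `μ = 0`, Ferrero–Washington, GZK} and K2's `∀`-body INLINE; **(P3)** `not_mem_seven_smul_top_of_lengthAt_eq_zero_of_ne_zero`
  (the converse at every NON-ZERO class, `∀`-shape) and the `KatoPrimitiveSeven`-shaped corollary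
  `lengthAt_seven_quotient_span_eq_zero_of_residualNonvanishing` (+ its converse at non-zero classes).

NOTE for consumers: the input `hchar : classicalMuVanishes_finite_unramifiedClasses` is a DISCHARGED named fact — the tree
theorem `Literature.NumberTheory.IwasawaTheory.ClassicalMuVanishesUnramifiedClasses.classicalMuVanishes_finite_unramifiedClasses_holds`
(module `Literature.NumberTheory.IwasawaTheory.ClassicalMuVanishesUnramifiedClassesProofs`, not among this file's ten imports,
which are REV 2.1's by the SUMMON's bounds) — so a skeleton may feed it by name instead of citing it; Ferrero–Washington
(`hFW`) and GZK (`hGZK`, the crux's own antecedent) have no `_holds`.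

HONEST LABEL: conditional reductions only; K2 («`z̄₀ ≠ 0` in `𝐇¹/7`») and stub 2b remain RESEARCH; nothing about Kato's
Conj. 12.10, `X12.CMRamifiedSeven` or BSD is asserted; 19945 stays OPEN; no summit statement is proved by this seat; BSD is
proved for no curve.  References: K. Kato, Astérisque 295 (2004) Thm. 12.4, Conj. 12.10 [Kato2004Asterisque]; J. Coates,
R. Sujatha, Math. Ann. 331 (2005) Cor. 3.6 [CoatesSujatha2005]; B. Ferrero, L. Washington, Ann. of Math. 109 (1979)
[FerreroWashington1979]; R. Greenberg, LNM 1716 (1999) §1 [GreenbergLNM1716]; L. Washington, GTM 83 §7.1, §13.2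
[Washington1997]; B. Mazur, Invent. Math. 44 (1978) Thm. 1 [Mazur1978]; A. Burungale, Y. Tian, Ann. of Math. 203 (2026)
Rem. 2.7 [BurungaleTian2026].
-/

noncomputable section

open scoped Classical NumberField

open WeierstrassCurve Literature.NumberTheory.EllipticCurves
open Literature.NumberTheory.EllipticCurves.Rank1Residual
open Literature.NumberTheory.EllipticCurves.Rank1Residual.Typed
open Literature.NumberTheory.EllipticCurves.IwasawaAlgebra
open Literature.NumberTheory.EllipticCurves.Kato2004
open Literature.NumberTheory.IwasawaTheory
open Summit.BirchSwinnertonDyer.Rank1Residual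
open Summit.BirchSwinnertonDyer.Rank1Residual.Additive
open Summit.BirchSwinnertonDyer.Rank1Residual.X12.O11

namespace Summit.BirchSwinnertonDyer.Rank1Residual.Additive.KatoMuResidual

/-! ## §1 The Selmer side at `(7)` on `𝒞₇`: statement (A) and `length_{(7)} Y.X = 0` -/

/-- **Statement (A) on `𝒞₇` at `p = 7`** — `X₀(W/K)` is finitely generated over `ℤ_7` for every member `W` of `𝒞₇` and
every cyclotomic `ℤ_7`-extension `K/ℚ` (tree spelling `∃ γ D, Module.Finite ℤ_[7] D.X`): `W` has CM by `ℚ(√−7)`, `7`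
ramifies there, so `W[7]` is reducible and the Borel-field road (char-form `μ = 0` + Ferrero–Washington) applies.
[cite: CoatesSujatha2005, Cor. 3.6] [cite: FerreroWashington1979, main theorem] [cite: Mazur1978, Thm 1 (Introduction, pp. 129–130)] -/
theorem conjA_seven_of_classCSeven
    (hchar : classicalMuVanishes_finite_unramifiedClasses) (hFW : ferreroWashington1979_classicalMuVanishes)
    (W : WeierstrassCurve ℚ) [W.IsElliptic] [W.IsGloballyMinimal] [Fact (Nat.Prime 7)] (hC : X12.ClassCSeven W)
    (K : ZpExtension ℚ 7) (hK : K.IsCyclotomic) :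
    ∃ (γ : Field.absoluteGaloisGroup ℚ) (D : W.FineSelmerDualData K γ),
      Module.Finite ℤ_[7] (RestrictScalars ℤ_[7] (IwasawaAlgebra 7) D.X) :=
  Summit.BirchSwinnertonDyer.BirchSwinnertonDyer.Theorems.ReducibleFineSelmerMuZeroCharForm.fineSelmerDual_moduleFinite_of_not_irreducible_of_charForm
    hchar hFW W 7 (by decide) (X12.red_of_cmRamified W 7 hC.1 (by decide) (X12.ClassCSeven.cmRamified_seven hC)) K hK

/-- **`Sel₀(W/K)[7]` is finite on `𝒞₇`** (statement (A) read through the tree's `Module.Finite ℤ_p ↔ finite p-torsion`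
dictionary at a normalised topological generator `γ`). [cite: CoatesSujatha2005, Cor. 3.6]
[cite: GreenbergLNM1716, §1 p. 60 (after Conj. 1.3)] -/
theorem finite_sevenTorsion_fineSelmerInfty_of_classCSeven
    (hchar : classicalMuVanishes_finite_unramifiedClasses) (hFW : ferreroWashington1979_classicalMuVanishes)
    (W : WeierstrassCurve ℚ) [W.IsElliptic] [W.IsGloballyMinimal] [Fact (Nat.Prime 7)] (hC : X12.ClassCSeven W)
    (K : ZpExtension ℚ 7) (hK : K.IsCyclotomic) {γ : Field.absoluteGaloisGroup ℚ} (hγ : K.IsTopGenerator γ) :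
    Set.Finite {s : W.fineSelmerInfty K | (7 : ℕ) • s = 0} :=
  (IwasawaModuleFinitePadicInt.exists_fineSelmerDualData_moduleFinite_iff_finite_pTorsion W K hγ).mp
    (conjA_seven_of_classCSeven hchar hFW W hC K hK)

/-- **Nakayama for the dual fine Selmer pair at an ARBITRARY key `γ'`**: a dual fine Selmer datum `Y` of any key over
any `ℤ_p`-extension of a number field is finitely generated over `Λ` once `Sel₀(K_∞, E[p^∞])[p]` is finite.  The tree's
`FineSelmerDualData.module_finite_of_finite_pTorsion` VERBATIM minus its hypothesis `κ.IsTopGenerator γ`, which was only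
used for local nilpotence of `conj_γ − 1`; at an arbitrary key that is the tree's `isLocNil_conjFineSelmerInfty_sub_one'`.
[cite: GreenbergLNM1716, §1 p. 60 (after Conj. 1.3)] [cite: Lang1990, Ch. 5 §1 (Nakayama's lemma)] -/
theorem moduleFinite_fineSelmerDual_of_finite_pTorsion_anyKey {F : Type*} [Field F] [NumberField F]
    {V : WeierstrassCurve F} {p : ℕ} [Fact p.Prime] {κ : ZpExtension F p} {γ' : Field.absoluteGaloisGroup F}
    (Y : V.FineSelmerDualData κ γ') (hfin : Set.Finite {s : V.fineSelmerInfty κ | p • s = 0}) :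
    Module.Finite (IwasawaAlgebra p) Y.X := by
  have hpair : IwasawaDual.IsDualPair p (V.conjFineSelmerInfty κ γ' - 1) Y.toDual :=
    { bijective := Y.bijective
      T_smul := fun x s ↦ by
        rw [Y.toDual_T_smul, IwasawaDual.End_sub_apply, AddMonoid.End.one_apply, map_sub]
        rfl
      C_smul := fun c x s k hk ↦ Y.toDual_C_smul c x s k hk
      locNil := V.isLocNil_conjFineSelmerInfty_sub_one' κ γ' }
  refine hpair.module_finite ?_
  refine hfin.subset fun s hs ↦ ?_
  obtain ⟨hs1, -⟩ := hs
  rw [pow_one] at hs1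
  exact hs1

/-- **The Selmer side of the `μ`-equality vanishes: `length_{(7)} Y.X = 0`** for EVERY dual fine Selmer datum `Y`, of ANY
key `γ'` (in particular the contragredient key `γ⁻¹` of stub 2b), of a `𝒞₇` member — `Sel₀[7]` finite (statement (A)),
`Y.X` finitely generated (Nakayama, any key), `Y.X ⧸ 7` finite, hence `length_{(7)} = 0`.
[cite: CoatesSujatha2005, Cor. 3.6] [cite: GreenbergLNM1716, §1 p. 60 (after Conj. 1.3)] [cite: Washington1997, §13.2] -/
theorem lengthAt_seven_fineSelmerDual_eq_zero_of_classCSeven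
    (hchar : classicalMuVanishes_finite_unramifiedClasses) (hFW : ferreroWashington1979_classicalMuVanishes)
    (W : WeierstrassCurve ℚ) [W.IsElliptic] [W.IsGloballyMinimal] [Fact (Nat.Prime 7)] (hC : X12.ClassCSeven W)
    (K : ZpExtension ℚ 7) (hK : K.IsCyclotomic) {γ : Field.absoluteGaloisGroup ℚ} (hγ : K.IsTopGenerator γ)
    {γ' : Field.absoluteGaloisGroup ℚ} (Y : W.FineSelmerDualData K γ')
    (𝔮 : PrimeSpectrum (IwasawaAlgebra 7)) (h𝔮 : 𝔮.asIdeal = IwasawaAlgebra.augIdealP 7) :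
    Module.lengthAt (IwasawaAlgebra 7) Y.X 𝔮 = 0 := by
  have hfin := finite_sevenTorsion_fineSelmerInfty_of_classCSeven hchar hFW W hC K hK hγ
  haveI : Module.Finite (IwasawaAlgebra 7) Y.X := moduleFinite_fineSelmerDual_of_finite_pTorsion_anyKey Y hfin
  haveI := Y.finite_quotient_augIdealP_of_finite_pTorsion hfin
  exact Summit.BirchSwinnertonDyer.BirchSwinnertonDyer.Rank1Residual.KatoMuSkeleton.lengthAt_eq_zero_of_finite_quotient_p
    (M := Y.X) 𝔮 h𝔮

/-! ## §2 The zeta side at `(7)`: `z ∉ 7·𝐇¹` versus `length_{(7)}(𝐇¹ ⧸ Λz) = 0` (DVR arithmetic in `Λ_{(7)}`) -/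

/-- **Bridge `p ∤ #W(ℚ)_tors ⟹ W(ℚ)[p] = 0`** in the `AddSubgroup.torsionBy … (p : ℤ) = ⊥` currency of
`IwasawaH1Data.moduleFree_of_torsionBy_eq_bot` (a non-zero `P` with `p • P = 0` has order `p` in the finite group
`E(ℚ)_tors`).  The tree has this only inside crux workfiles (`lean search`), hence re-proved here.
[cite: SilvermanAEC2009, Cor. VIII.6.7.1 (finiteness of `E(K)_tors`)] -/
theorem torsionBy_eq_bot_of_not_dvd_torsionOrder (W : WeierstrassCurve ℚ) [W.IsElliptic] (p : ℕ)
    [hp : Fact p.Prime] (h : ¬ p ∣ W.torsionOrder) :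
    AddSubgroup.torsionBy W.toAffine.Point (p : ℤ) = ⊥ := by
  haveI hfin : Finite (AddCommGroup.torsion W.toAffine.Point) := by
    convert W.finite_torsion_point
  have h' : ¬ p ∣ Nat.card (AddCommGroup.torsion W.toAffine.Point) := by
    unfold WeierstrassCurve.torsionOrder at h
    convert h
  refine (AddSubgroup.eq_bot_iff_forall _).mpr fun P hP ↦ ?_
  by_contra hP0
  have hpP : p • P = 0 := AddSubgroup.torsionBy.nsmul_iff.mp hP
  have hord : addOrderOf P = p := addOrderOf_eq_prime hpP hP0
  have hmem : P ∈ AddCommGroup.torsion W.toAffine.Point :=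
    (AddCommGroup.mem_torsion P).2 (isOfFinAddOrder_iff_nsmul_eq_zero.2 ⟨p, hp.out.pos, hpP⟩)
  exact h' (hord ▸ AddSubgroup.addOrderOf_dvd_natCard _ hmem)

/-- **On `𝒞₇`, granted GZK: a class `z ∉ 7·𝐇¹` has `length_{(7)}(𝐇¹ ⧸ Λz) = 0`** (for ANY `z ∈ 𝐇¹ = I.H`, admissible
or not, and any `ContinuousSMul` structure on `T₇W`).  Ingredients, ALL tree theorems: `𝐇¹` torsion free
(`noZeroSMulDivisors`), FREE (Kato Thm. 12.4 (3): `moduleFree_of_torsionBy_eq_bot`, hypothesis `W(ℚ)[7] = 0` from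
`not_seven_dvd_torsionOrder` on `𝒞₇`), of rank `≤ 1` ((R1) `LocPKummer.rank_integralH1_le_one` — Mordell–Weil rank one
and `Ш(W)` finite, i.e. GZK at analytic rank one — then (R2) `rank_eq_one_of_rank_integralH1_le_one` as `z ≠ 0`); so
`𝐇¹ = Λ·e`, `𝐇¹ ⧸ Λz` is finitely generated over `ℤ_7` (`z = β e`, `β ∉ (7)`, Weierstrass preparation) and
`length_{(7)} = 0`.  FREENESS is load-bearing (`𝔪 = (7,T)`, `z = 7 ∉ 7𝔪`, `length_{(7)}(𝔪 ⧸ Λ·7) = 1`).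
[cite: Kato2004Asterisque, Thm. 12.4 (2)(3) (p. 221), §13.8 (pp. 228–229)] [cite: Washington1997, §7.1 Thm. 7.3, §13.2] -/
theorem lengthAt_seven_quotient_span_eq_zero_of_not_mem (hGZK : rank_eq_analyticRank_of_analyticRank_le_one)
    (W : WeierstrassCurve ℚ) [W.IsElliptic] [W.IsGloballyMinimal] [Fact (Nat.Prime 7)] (hC : X12.ClassCSeven W)
    [ContinuousSMul ℤ_[7] (W.tateModule 7)] {K : ZpExtension ℚ 7} (hK : K.IsCyclotomic)
    {γ : Field.absoluteGaloisGroup ℚ} (hγ : K.IsTopGenerator γ) (I : IwasawaH1Data W 7 K γ) {z : I.H}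
    (hz : z ∉ (IwasawaAlgebra.augIdealP 7 • (⊤ : Submodule (IwasawaAlgebra 7) I.H)))
    (𝔮 : PrimeSpectrum (IwasawaAlgebra 7)) (h7 : 𝔮.asIdeal = IwasawaAlgebra.augIdealP 7) :
    Module.lengthAt (IwasawaAlgebra 7) (I.H ⧸ (IwasawaAlgebra 7) ∙ z) 𝔮 = 0 := by
  have hz0 : z ≠ 0 := by
    rintro rfl
    exact hz (Submodule.zero_mem _)
  -- rank-one inputs on `𝒞₇` from GZK: Mordell–Weil rank one and `Ш(W)` finite
  have hr : W.analyticRank = 1 := hC.2.2.1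
  have hrank : W.mordellWeilRank = 1 := by rw [(hGZK W hr.le).1, hr]
  haveI : Finite W.sha := (hGZK W hr.le).2
  have hsha : Finite (AddCommGroup.primaryComponent W.sha 7) := inferInstance
  have hR1 := LocPKummer.rank_integralH1_le_one W 7 K hrank hsha
  -- `𝐇¹` is torsion free, free, of rank one
  haveI := I.noZeroSMulDivisors hγ
  haveI : Nontrivial I.H := ⟨⟨z, 0, hz0⟩⟩
  have hrk : Module.rank (IwasawaAlgebra 7) I.H = 1 := I.rank_eq_one_of_rank_integralH1_le_one hK hγ hR1
  haveI : Module.Free (IwasawaAlgebra 7) I.H :=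
    I.moduleFree_of_torsionBy_eq_bot hK hγ
      (torsionBy_eq_bot_of_not_dvd_torsionOrder W 7
        (Summit.BirchSwinnertonDyer.BirchSwinnertonDyer.Theorems.RamifiedSevenEllipticUnits.ValueOfKMCPerrinRiou.not_seven_dvd_torsionOrder
          W hC))
  obtain ⟨e, he, hgen⟩ := exists_generator_of_moduleFree_of_rank_eq_one (p := 7) hrk
  -- `𝐇¹ ⧸ Λz` is finitely generated over `ℤ_7`, hence `length_{(7)} = 0`
  have hfg := moduleFinite_quotient_span_of_generator_of_not_mem_augIdealP_smul_top (p := 7) he hgen hz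
  letI : _root_.Module ℤ_[7] (I.H ⧸ (IwasawaAlgebra 7) ∙ z) :=
    Module.compHom _ (algebraMap ℤ_[7] (IwasawaAlgebra 7))
  haveI : IsScalarTower ℤ_[7] (IwasawaAlgebra 7) (I.H ⧸ (IwasawaAlgebra 7) ∙ z) :=
    IsScalarTower.of_compHom ℤ_[7] _ _
  haveI : Module.Finite ℤ_[7] (I.H ⧸ (IwasawaAlgebra 7) ∙ z) := hfg
  exact lengthAt_eq_zero_of_finite 7 (I.H ⧸ (IwasawaAlgebra 7) ∙ z) 𝔮 h7

/-- **(P3, core) The converse holds UNCONDITIONALLY (no `𝒞₇`, no GZK, no freeness): a NON-ZERO class with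
`length_{(7)}(𝐇¹ ⧸ Λz) = 0` is not divisible by `7` in `𝐇¹`** — `𝐇¹` is finitely generated (12.2.1) and torsion free, so
`length_{(7)} = 0` makes `𝐇¹ ⧸ Λz` finitely generated over `ℤ_7` (`finite_of_lengthAt_eq_zero`, Weierstrass division), which
a `7`-divisible class in a non-zero torsion-free `Λ`-module forbids (`not_moduleFinite_quotient_span_of_mem_augIdealP_smul_top`).
[cite: Washington1997, §13.2] [cite: Kato2004Asterisque, Thm. 12.4 (2) (p. 221), §17.13 (p. 280) (shape)] -/
theorem not_mem_seven_smul_top_of_lengthAt_quotient_span_eq_zero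
    (W : WeierstrassCurve ℚ) [W.IsElliptic] [Fact (Nat.Prime 7)] [ContinuousSMul ℤ_[7] (W.tateModule 7)]
    {K : ZpExtension ℚ 7} (hK : K.IsCyclotomic) {γ : Field.absoluteGaloisGroup ℚ} (hγ : K.IsTopGenerator γ)
    (I : IwasawaH1Data W 7 K γ) {z : I.H} (hz0 : z ≠ 0)
    (𝔮 : PrimeSpectrum (IwasawaAlgebra 7)) (h7 : 𝔮.asIdeal = IwasawaAlgebra.augIdealP 7)
    (h : Module.lengthAt (IwasawaAlgebra 7) (I.H ⧸ (IwasawaAlgebra 7) ∙ z) 𝔮 = 0) :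
    z ∉ (IwasawaAlgebra.augIdealP 7 • (⊤ : Submodule (IwasawaAlgebra 7) I.H)) := by
  haveI := IwasawaH1Data.module_finite_of_isCyclotomic hK hγ I
  haveI := I.noZeroSMulDivisors hγ
  haveI : Nontrivial I.H := ⟨⟨z, 0, hz0⟩⟩
  intro hmem
  letI : _root_.Module ℤ_[7] (I.H ⧸ (IwasawaAlgebra 7) ∙ z) :=
    Module.compHom _ (algebraMap ℤ_[7] (IwasawaAlgebra 7))
  haveI : IsScalarTower ℤ_[7] (IwasawaAlgebra 7) (I.H ⧸ (IwasawaAlgebra 7) ∙ z) :=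
    IsScalarTower.of_compHom ℤ_[7] _ _
  have hfin : Module.Finite ℤ_[7] (I.H ⧸ (IwasawaAlgebra 7) ∙ z) :=
    finite_of_lengthAt_eq_zero 7 (I.H ⧸ (IwasawaAlgebra 7) ∙ z) 𝔮 h7 h
  exact not_moduleFinite_quotient_span_of_mem_augIdealP_smul_top (p := 7) hmem hfin

/-- **(P3, iff) On `𝒞₇`, granted GZK, for every NON-ZERO class `z ∈ 𝐇¹`: `length_{(7)}(𝐇¹ ⧸ Λz) = 0 ⟺ z ∉ 7·𝐇¹`.**
[cite: Kato2004Asterisque, Thm. 12.4 (2)(3) (p. 221)] [cite: Washington1997, §13.2] -/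
theorem lengthAt_seven_quotient_span_eq_zero_iff_not_mem (hGZK : rank_eq_analyticRank_of_analyticRank_le_one)
    (W : WeierstrassCurve ℚ) [W.IsElliptic] [W.IsGloballyMinimal] [Fact (Nat.Prime 7)] (hC : X12.ClassCSeven W)
    [ContinuousSMul ℤ_[7] (W.tateModule 7)] {K : ZpExtension ℚ 7} (hK : K.IsCyclotomic)
    {γ : Field.absoluteGaloisGroup ℚ} (hγ : K.IsTopGenerator γ) (I : IwasawaH1Data W 7 K γ) {z : I.H} (hz0 : z ≠ 0)
    (𝔮 : PrimeSpectrum (IwasawaAlgebra 7)) (h7 : 𝔮.asIdeal = IwasawaAlgebra.augIdealP 7) :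
    Module.lengthAt (IwasawaAlgebra 7) (I.H ⧸ (IwasawaAlgebra 7) ∙ z) 𝔮 = 0 ↔
      z ∉ (IwasawaAlgebra.augIdealP 7 • (⊤ : Submodule (IwasawaAlgebra 7) I.H)) :=
  ⟨not_mem_seven_smul_top_of_lengthAt_quotient_span_eq_zero W hK hγ I hz0 𝔮 h7,
    fun hz ↦ lengthAt_seven_quotient_span_eq_zero_of_not_mem hGZK W hC hK hγ I hz 𝔮 h7⟩

/-! ## §3 The skeleton-facing statements (P1), (P2), (P3) -/

/-- **(P1) Kato's `μ`-EQUALITY AT `(7)` AT ONE MEMBER AND ONE CLASS, from residual non-vanishing of THAT class**: for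
`W ∈ 𝒞₇`, a cyclotomic `ℤ_7`-datum with pin, `z₀ ∈ 𝐇¹ = I.H` with `z₀ ∉ (7)·𝐇¹`, every dual fine Selmer datum `Y` of the
contragredient key and every `𝔮` with `𝔮 = (7)`: `length_𝔮 Y.X = length_𝔮 (𝐇¹ ⧸ Λz₀)` — both sides are `0` (§1: statement
(A) on `𝒞₇` from {char-form `μ = 0`, Ferrero–Washington}; §2: `𝐇¹` free of rank one under GZK).  NO admissibility and NO
`height = 1` hypothesis.  The type is the planner's `portP1_standin` letter for letter.  CONDITIONAL on the three displayed
hypotheses; nothing asserted about K2, Conj. 12.10 or 19945.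
[cite: Kato2004Asterisque, Conj. 12.10 (p. 224), Thm. 12.4 (2)(3) (p. 221)] [cite: CoatesSujatha2005, Cor. 3.6]
[cite: BurungaleTian2026, Rem. 2.7 (p. 5)] -/
theorem lengthAt_seven_fineSelmerDual_eq_lengthAt_quotient_span_of_not_mem
    (hchar : classicalMuVanishes_finite_unramifiedClasses) (hFW : ferreroWashington1979_classicalMuVanishes)
    (hGZK : rank_eq_analyticRank_of_analyticRank_le_one) :
    ∀ (W : WeierstrassCurve ℚ) [W.IsElliptic] [W.IsGloballyMinimal] [Fact (Nat.Prime 7)], X12.ClassCSeven W →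
      letI : ContinuousSMul ℤ_[7] (W.tateModule 7) := TateModule.continuousSMul_padicInt
      ∀ (K : ZpExtension ℚ 7) (hK : K.IsCyclotomic) (γ : Field.absoluteGaloisGroup ℚ) (_ : K.IsTopGenerator γ)
        (I : IwasawaH1Data W 7 K γ) (z₀ : I.H),
        z₀ ∉ (IwasawaAlgebra.augIdealP 7 • (⊤ : Submodule (IwasawaAlgebra 7) I.H)) →
        ∀ (Y : W.FineSelmerDualData K γ⁻¹) (𝔮 : PrimeSpectrum (IwasawaAlgebra 7)),
          𝔮.asIdeal = IwasawaAlgebra.augIdealP 7 →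
          Module.lengthAt (IwasawaAlgebra 7) Y.X 𝔮 =
            Module.lengthAt (IwasawaAlgebra 7) (I.H ⧸ (IwasawaAlgebra 7) ∙ z₀) 𝔮 := by
  intro W _ _ _ hC K hK γ hγ I z₀ hz₀ Y 𝔮 h7
  haveI : ContinuousSMul ℤ_[7] (W.tateModule 7) := TateModule.continuousSMul_padicInt
  rw [lengthAt_seven_fineSelmerDual_eq_zero_of_classCSeven hchar hFW W hC K hK hγ Y 𝔮 h7]
  exact (lengthAt_seven_quotient_span_eq_zero_of_not_mem hGZK W hC hK hγ I hz₀ 𝔮 h7).symm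

/-- **(P2) STUB 2b VERBATIM ⟸ {char-form `μ = 0`, Ferrero–Washington, GZK} ∧ K2 (residual non-vanishing, its `∀`-body
INLINE as `hK2`)**: the conclusion below is letter-for-letter the type of `KatoPerrinRiouZp.stub_katoMuEqualitySeven`
(skeleton of record v9, `7f643694dfb0cab1`, l. 229–237); admissibility and `height = 1` are only threaded through to `hK2`.
CONDITIONAL; nothing asserted; 19945 stays OPEN.
[cite: Kato2004Asterisque, Conj. 12.10 (p. 224), Thm. 12.4 (2)(3) (p. 221)] [cite: CoatesSujatha2005, Cor. 3.6]
[cite: BurungaleTian2026, Rem. 2.7 (p. 5)] -/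
theorem stubKatoMuEqualitySeven_of_residualNonvanishing
    (hchar : classicalMuVanishes_finite_unramifiedClasses) (hFW : ferreroWashington1979_classicalMuVanishes)
    (hGZK : rank_eq_analyticRank_of_analyticRank_le_one)
    (hK2 : ∀ (W : WeierstrassCurve ℚ) [W.IsElliptic] [W.IsGloballyMinimal] [Fact (Nat.Prime 7)], X12.ClassCSeven W →
      letI : ContinuousSMul ℤ_[7] (W.tateModule 7) := TateModule.continuousSMul_padicInt
      ∀ (K : ZpExtension ℚ 7) (hK : K.IsCyclotomic) (γ : Field.absoluteGaloisGroup ℚ) (_ : K.IsTopGenerator γ)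
        (I : IwasawaH1Data W 7 K γ) (z₀ : I.H), Kato2004.IsAdmissibleZetaClass W 7 K hK I z₀ →
        z₀ ∉ (IwasawaAlgebra.augIdealP 7 • (⊤ : Submodule (IwasawaAlgebra 7) I.H))) :
    ∀ (W : WeierstrassCurve ℚ) [W.IsElliptic] [W.IsGloballyMinimal] [Fact (Nat.Prime 7)], X12.ClassCSeven W →
      letI : ContinuousSMul ℤ_[7] (W.tateModule 7) := TateModule.continuousSMul_padicInt
      ∀ (K : ZpExtension ℚ 7) (hK : K.IsCyclotomic) (γ : Field.absoluteGaloisGroup ℚ) (_ : K.IsTopGenerator γ)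
        (I : IwasawaH1Data W 7 K γ) (z₀ : I.H), Kato2004.IsAdmissibleZetaClass W 7 K hK I z₀ →
        ∀ (Y : W.FineSelmerDualData K γ⁻¹) (𝔮 : PrimeSpectrum (IwasawaAlgebra 7)), 𝔮.asIdeal.height = 1 →
          𝔮.asIdeal = IwasawaAlgebra.augIdealP 7 →
          Module.lengthAt (IwasawaAlgebra 7) Y.X 𝔮 =
            Module.lengthAt (IwasawaAlgebra 7) (I.H ⧸ (IwasawaAlgebra 7) ∙ z₀) 𝔮 :=
  fun W _ _ _ hC K hK γ hγ I z₀ hz₀ Y 𝔮 _ h7 ↦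
    lengthAt_seven_fineSelmerDual_eq_lengthAt_quotient_span_of_not_mem hchar hFW hGZK W hC K hK γ hγ I z₀
      (hK2 W hC K hK γ hγ I z₀ hz₀) Y 𝔮 h7

/-- **(P3) The converse at every NON-ZERO class, `∀`-shape, with NO hypothesis** (no `𝒞₇`, no GZK, no admissibility): if
`length_{(7)}(𝐇¹ ⧸ Λz₀) = 0` at the height-one prime `(7)` and `z₀ ≠ 0`, then `z₀ ∉ (7)·𝐇¹`.  (At `z₀ = 0` the length side
is about `𝐇¹ ⧸ 0 = 𝐇¹` and the two statements can differ; this is the only loss in the transfer `2b′ ↝ K2`.)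
[cite: Washington1997, §13.2] [cite: Kato2004Asterisque, Thm. 12.4 (2) (p. 221)] -/
theorem not_mem_seven_smul_top_of_lengthAt_eq_zero_of_ne_zero :
    ∀ (W : WeierstrassCurve ℚ) [W.IsElliptic] [Fact (Nat.Prime 7)] [ContinuousSMul ℤ_[7] (W.tateModule 7)]
      (K : ZpExtension ℚ 7) (_ : K.IsCyclotomic) (γ : Field.absoluteGaloisGroup ℚ) (_ : K.IsTopGenerator γ)
      (I : IwasawaH1Data W 7 K γ) (z₀ : I.H) (𝔮 : PrimeSpectrum (IwasawaAlgebra 7)),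
      𝔮.asIdeal = IwasawaAlgebra.augIdealP 7 →
      Module.lengthAt (IwasawaAlgebra 7) (I.H ⧸ (IwasawaAlgebra 7) ∙ z₀) 𝔮 = 0 → z₀ ≠ 0 →
      z₀ ∉ (IwasawaAlgebra.augIdealP 7 • (⊤ : Submodule (IwasawaAlgebra 7) I.H)) :=
  fun W _ _ _ _K hK _γ hγ I _z₀ 𝔮 h7 h hne ↦
    not_mem_seven_smul_top_of_lengthAt_quotient_span_eq_zero W hK hγ I hne 𝔮 h7 h

/-- **K3 in `∀`-shape — on `𝒞₇`, granted GZK, K2 (residual non-vanishing at every admissible class, INLINE) ⟹ 2b′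
(`KatoPrimitiveSeven` INLINE: `length_{(7)}(𝐇¹ ⧸ Λz₀) = 0` at every admissible class).**  CONDITIONAL; nothing asserted.
[cite: Kato2004Asterisque, Thm. 12.4 (2)(3) (p. 221), §13.8 (pp. 228–229), Conj. 12.10 (p. 224)] [cite: Washington1997, §7.1 Thm. 7.3, §13.2] -/
theorem lengthAt_seven_quotient_span_eq_zero_of_residualNonvanishing
    (hGZK : rank_eq_analyticRank_of_analyticRank_le_one)
    (hK2 : ∀ (W : WeierstrassCurve ℚ) [W.IsElliptic] [W.IsGloballyMinimal] [Fact (Nat.Prime 7)], X12.ClassCSeven W →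
      letI : ContinuousSMul ℤ_[7] (W.tateModule 7) := TateModule.continuousSMul_padicInt
      ∀ (K : ZpExtension ℚ 7) (hK : K.IsCyclotomic) (γ : Field.absoluteGaloisGroup ℚ) (_ : K.IsTopGenerator γ)
        (I : IwasawaH1Data W 7 K γ) (z₀ : I.H), Kato2004.IsAdmissibleZetaClass W 7 K hK I z₀ →
        z₀ ∉ (IwasawaAlgebra.augIdealP 7 • (⊤ : Submodule (IwasawaAlgebra 7) I.H))) :
    ∀ (W : WeierstrassCurve ℚ) [W.IsElliptic] [W.IsGloballyMinimal] [Fact (Nat.Prime 7)], X12.ClassCSeven W →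
      letI : ContinuousSMul ℤ_[7] (W.tateModule 7) := TateModule.continuousSMul_padicInt
      ∀ (K : ZpExtension ℚ 7) (hK : K.IsCyclotomic) (γ : Field.absoluteGaloisGroup ℚ) (_ : K.IsTopGenerator γ)
        (I : IwasawaH1Data W 7 K γ) (z₀ : I.H), Kato2004.IsAdmissibleZetaClass W 7 K hK I z₀ →
        ∀ (𝔮 : PrimeSpectrum (IwasawaAlgebra 7)), 𝔮.asIdeal.height = 1 →
          𝔮.asIdeal = IwasawaAlgebra.augIdealP 7 →
          Module.lengthAt (IwasawaAlgebra 7) (I.H ⧸ (IwasawaAlgebra 7) ∙ z₀) 𝔮 = 0 := by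
  intro W _ _ _ hC K hK γ hγ I z₀ hz₀ 𝔮 _ h7
  haveI : ContinuousSMul ℤ_[7] (W.tateModule 7) := TateModule.continuousSMul_padicInt
  exact lengthAt_seven_quotient_span_eq_zero_of_not_mem hGZK W hC hK hγ I (hK2 W hC K hK γ hγ I z₀ hz₀) 𝔮 h7

/-- … and conversely **2b′ (`KatoPrimitiveSeven` INLINE) ⟹ K2 at every NON-ZERO admissible class**, with no hypothesis at
all: the card's transfer `2b′ ↝ K2` is LOSSLESS away from the zero class.
[cite: Washington1997, §13.2] [cite: Kato2004Asterisque, Thm. 12.4 (2) (p. 221), Conj. 12.10 (p. 224)] -/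
theorem residualNonvanishing_of_lengthAt_seven_quotient_span_eq_zero_of_ne_zero
    (hprim : ∀ (W : WeierstrassCurve ℚ) [W.IsElliptic] [W.IsGloballyMinimal] [Fact (Nat.Prime 7)], X12.ClassCSeven W →
      letI : ContinuousSMul ℤ_[7] (W.tateModule 7) := TateModule.continuousSMul_padicInt
      ∀ (K : ZpExtension ℚ 7) (hK : K.IsCyclotomic) (γ : Field.absoluteGaloisGroup ℚ) (_ : K.IsTopGenerator γ)
        (I : IwasawaH1Data W 7 K γ) (z₀ : I.H), Kato2004.IsAdmissibleZetaClass W 7 K hK I z₀ →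
        ∀ (𝔮 : PrimeSpectrum (IwasawaAlgebra 7)), 𝔮.asIdeal.height = 1 →
          𝔮.asIdeal = IwasawaAlgebra.augIdealP 7 →
          Module.lengthAt (IwasawaAlgebra 7) (I.H ⧸ (IwasawaAlgebra 7) ∙ z₀) 𝔮 = 0) :
    ∀ (W : WeierstrassCurve ℚ) [W.IsElliptic] [W.IsGloballyMinimal] [Fact (Nat.Prime 7)], X12.ClassCSeven W →
      letI : ContinuousSMul ℤ_[7] (W.tateModule 7) := TateModule.continuousSMul_padicInt
      ∀ (K : ZpExtension ℚ 7) (hK : K.IsCyclotomic) (γ : Field.absoluteGaloisGroup ℚ) (_ : K.IsTopGenerator γ)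
        (I : IwasawaH1Data W 7 K γ) (z₀ : I.H), Kato2004.IsAdmissibleZetaClass W 7 K hK I z₀ → z₀ ≠ 0 →
        z₀ ∉ (IwasawaAlgebra.augIdealP 7 • (⊤ : Submodule (IwasawaAlgebra 7) I.H)) := by
  intro W _ _ _ hC K hK γ hγ I z₀ hz₀ hne
  haveI : ContinuousSMul ℤ_[7] (W.tateModule 7) := TateModule.continuousSMul_padicInt
  have hprime : (IwasawaAlgebra.augIdealP 7).IsPrime := IwasawaAlgebra.isPrime_augIdealP_holds 7
  exact not_mem_seven_smul_top_of_lengthAt_quotient_span_eq_zero W hK hγ I hne ⟨IwasawaAlgebra.augIdealP 7, hprime⟩ rfl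
    (hprim W hC K hK γ hγ I z₀ hz₀ ⟨IwasawaAlgebra.augIdealP 7, hprime⟩ (IwasawaAlgebra.height_augIdealP_holds 7) rfl)

end Summit.BirchSwinnertonDyer.Rank1Residual.Additive.KatoMuResidual

end
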